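import Literature.NumberTheory.LFunctions.PolynomialRootMoebiusRieszMean
import Mathlib.NumberTheory.EulerProduct.Basic
import HarnessLib

/-!
# The Bateman–Horn constant of one polynomial as the Abelian limit of its Euler product

Topic `Literature/NumberTheory/LFunctions` (sibling of `PolynomialRootMoebiusDirichlet.lean`,
`PolynomialRootMoebiusRieszMean.lean`; consumer of `IdealNormCount.lean`,
`PrimeSumTauberian.lean` and `Sieve/BatemanHornProofs.lean`).  Everything here is PROVED.

Let `g ∈ ℤ[X]` form a one-polynomial Bateman–Horn system (`IsBatemanHornSystem ![g]`:
irreducible, positive leading coefficient, no fixed prime divisor), `ρ_g(p) = #{r mod p :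
g(r) ≡ 0}` (`polyRootCountMod ![g] p`), and let
`C(![g]) = lim_x ∏_{p ≤ x} (1 − 1/p)⁻¹ (1 − ρ_g(p)/p)` be its Bateman–Horn constant
(`batemanHornConst ![g]`, an ORDERED, conditionally convergent product; existence and positivity:
`IsBatemanHornSystem.hasBatemanHornConst_holds`).  With `e_p(s) = (1 − p^{-s})⁻¹(1 − ρ_g(p)p^{-s})`:

* `tendsto_tsum_log_eulerFactorBH` — `Σ_p log e_p(s) → log C(![g])` as `s → 1⁺`;
* `tendsto_moebiusRootCount_mul_zetaReal` —
  `(Σ_n μ(n)ρ_g(n) n^{-s})·(Σ_n n^{-s}) → C(![g])` as `s → 1⁺` (real `s`), i.e.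
  **`C(![g]) = lim_{s → 1⁺} ζ(s) ∏_p (1 − ρ_g(p) p^{-s})`**: the ordered product at `s = 1` is
  the Abelian limit of the absolutely convergent Euler products (`tendsto_moebiusRootCountSeries_mul_zeta_batemanHornConst`).

This is the form in which the constant is USED analytically (main terms of sieves / of
Bateman–Horn-type asymptotics come out of Dirichlet series at `s = 1⁺`); the consumer
`PolynomialRootMoebiusRieszMeanConstant.lean` identifies Landau's log-Riesz constant of `μρ_g`
with `C(![g])` through it.

Proof.  `log e_p(s) = (1 − ρ_g(p))p^{-s} + u_p(s)` with `|u_p(s)| ≤ (2 + 2deg²g)p^{-2}` for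
`p > 2 deg g` and `≤ log p + 1` otherwise, uniformly in `s ≥ 1` (`abs_log_eulerFactorBH_sub_le`),
so Tannery's theorem lets `s → 1⁺` in `Σ_p u_p(s)`.  The Abelian limit
`S = lim_{s→1⁺} Σ_p (1 − ρ_g(p))p^{-s}` EXISTS because `ρ_g(p) = c_K(p)` (degree-one prime count of
`K = ℚ[X]/(g₁)`, `g₁` the monic integral normalisation) off finitely many `p`
(`exists_rootExcess_prime_eq_zero`) and `Σ_p (c_K(p) − 1)p^{-s}` converges as `s → 1⁺`
(`exists_tendsto_tsum_primes_idealNormCount_sub_one`: `log ζ_K − log ζ` and the class number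
formula residue).  The tree's Hardy–Littlewood–Karamata Tauberian theorem for prime sums
(`PrimeSum.tendsto_sum_primesLE_div`) then gives `Σ_{p ≤ x} (1 − ρ_g(p))/p → S` for the SAME `S`,
whence `Σ_{p ≤ x} log e_p(1) → S + Σ_p u_p(1)`; but the left side is `log` of the Bateman–Horn
partial product, which tends to `log C(![g])`.  Hence `Σ_p log e_p(s) → S + Σ_p u_p(1) = log C(![g])`.
Finally, for `s > 1` the Euler products of `Σ μ(n)ρ_g(n)n^{-s}` (Mathlib `EulerProduct.eulerProduct`,
`p`-factor `1 − ρ_g(p)p^{-s}`) and of `Σ n^{-s}` identify `exp Σ_p log e_p(s)` with their product.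

## References

* P. T. Bateman, R. A. Horn, *A heuristic asymptotic formula concerning the distribution of
  prime numbers*, Math. Comp. 16 (1962), 363–367, §2, eq. (2) (the constant `C(f)` and the
  convergence of its product). [cite: BatemanHornMathComp1962, §2 eq. (2)]
* H. Davenport, A. Schinzel, *A note on certain arithmetical constants*, Illinois J. Math. 10
  (1966), 181–185 (the constants `C(f)`; convergence and positivity). [cite: DavenportSchinzel1966]
* H. L. Montgomery, R. C. Vaughan, *Multiplicative Number Theory I*, Cambridge 2007, Thm. 5.11
  (the Tauberian theorem used, via `PrimeSumTauberian.lean`). [cite: MontgomeryVaughan2007, Thm. 5.11]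
-/

noncomputable section

open Filter Finset Nat ArithmeticFunction Polynomial Complex
open scoped Topology BigOperators ArithmeticFunction.Moebius

namespace Literature.NumberTheory.LFunctions

open Literature.NumberTheory.Sieve

/-! The arithmetic functions are written with LOCAL NOTATION over Mathlib's
`toArithmeticFunction` (no new definitions), as in `PolynomialRootMoebiusDirichlet.lean`:
`μρ[g] = (n ↦ μ(n)ρ_g(n))`, `cK[K] = (n ↦ c_K(n))`, `hE[g, K] = μρ[g] * cK[K]`; and the real
Euler factor, its remainder majorant and the two real Dirichlet series are the local notations
`eBH(g, s, p)`, `bnd(g, p)`, `Fℝ(g, s)`, `ζℝ(s)` displayed below. -/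

/-- `a = μρ_g` as a complex arithmetic function (same local notation as upstream). -/
local notation "μρ[" g "]" => toArithmeticFunction (fun n : ℕ =>
  ((ArithmeticFunction.moebius n : ℤ) : ℂ) * ((Literature.NumberTheory.Sieve.polyRootCountMod ![g] n : ℕ) : ℂ))

/-- `c_K` as a complex arithmetic function (zeroed at `0`). -/
local notation "cK[" K "]" => toArithmeticFunction (fun n : ℕ =>
  ((Literature.NumberTheory.LFunctions.idealNormCount K n : ℕ) : ℂ))

/-- `h = a ⋆ c_K`. -/
local notation "hE[" g ", " K "]" => ((μρ[g]) * (cK[K]) : ArithmeticFunction ℂ)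

/-- The Euler factor `e_p(s) = (1 - p^{-s})⁻¹ (1 - ρ_g(p) p^{-s})` (real `s`). -/
local notation "eBH(" g ", " s ", " p ")" =>
  ((1 - (p : ℝ) ^ (-(s : ℝ)))⁻¹ * (1 - (polyRootCountMod ![g] p : ℝ) * (p : ℝ) ^ (-(s : ℝ))))

/-- The uniform majorant `(2 + 2 deg² g) p^{-2} + 𝟙[p ≤ 2 deg g](log p + 1)` of the second-order
remainder `log e_p(s) − (1 − ρ_g(p)) p^{-s}`, `s ≥ 1`. -/
local notation "bnd(" g ", " p ")" =>
  ((2 + 2 * ((Polynomial.natDegree g : ℕ) : ℝ) ^ 2) * (p : ℝ) ^ (-2 : ℝ) +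
    (ite ((p : ℕ) ≤ 2 * Polynomial.natDegree g) (Real.log (p : ℝ) + 1) 0))

/-- The real Dirichlet series `F(s) = Σ_n μ(n)ρ_g(n) n^{-s}`. -/
local notation "Fℝ(" g ", " s ")" =>
  (∑' n : ℕ, (ArithmeticFunction.moebius n : ℝ) * (polyRootCountMod ![g] n : ℝ) * (n : ℝ) ^ (-(s : ℝ)))

/-- The real zeta series `Σ_n n^{-s}`. -/
local notation "ζℝ(" s ")" => (∑' n : ℕ, (n : ℝ) ^ (-(s : ℝ)))

section RealSide

variable {g : ℤ[X]} (hg : IsBatemanHornSystem ![g])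
include hg

/-- The member of a one-polynomial Bateman–Horn system is irreducible. [folklore] -/
theorem bh_single_irreducible : Irreducible g := by simpa using hg.irreducible 0

/-- `ρ_g(p) ≤ deg g` at every prime. [folklore] -/
theorem bh_single_rootCount_le {p : ℕ} (hp : p.Prime) :
    (polyRootCountMod ![g] p : ℝ) ≤ g.natDegree := by
  exact_mod_cast polyRootCountMod_prime_le_natDegree_of_irreducible
    (bh_single_irreducible hg) (by simpa using hg.natDegree_pos 0) hp

/-- `ρ_g(p) ≤ p - 1` at every prime (no fixed prime divisor). [folklore] -/
theorem bh_single_rootCount_le_sub_one {p : ℕ} (hp : p.Prime) :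
    (polyRootCountMod ![g] p : ℝ) ≤ (p : ℝ) - 1 := by
  have h : polyRootCountMod ![g] p < p := hg.hasNoFixedPrimeDivisor p hp
  have h' : polyRootCountMod ![g] p + 1 ≤ p := h
  have := (Nat.cast_le (α := ℝ)).mpr h'
  push_cast at this
  linarith

omit hg in
/-- For a prime `p` and `s ≥ 1`: `0 < p^{-s} ≤ 1/p ≤ 1/2`. [folklore] -/
theorem rpow_neg_le_inv {p : ℕ} (hp : p.Prime) {s : ℝ} (hs : 1 ≤ s) :
    0 < (p : ℝ) ^ (-s) ∧ (p : ℝ) ^ (-s) ≤ (p : ℝ)⁻¹ ∧ (p : ℝ)⁻¹ ≤ 1 / 2 := by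
  have hp2 : (2 : ℝ) ≤ p := by exact_mod_cast hp.two_le
  have hp0 : (0 : ℝ) < p := by linarith
  refine ⟨Real.rpow_pos_of_pos hp0 _, ?_, ?_⟩
  · calc (p : ℝ) ^ (-s) ≤ (p : ℝ) ^ (-1 : ℝ) :=
          Real.rpow_le_rpow_of_exponent_le (by linarith) (by linarith)
      _ = (p : ℝ)⁻¹ := Real.rpow_neg_one _
  · rw [inv_eq_one_div]
    exact one_div_le_one_div_of_le (by norm_num) hp2

/-- A2a: positivity of the two factors of `e_p(s)` for `s ≥ 1`. [folklore] -/
theorem eulerFactorBH_parts_pos {p : ℕ} (hp : p.Prime) {s : ℝ} (hs : 1 ≤ s) :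
    0 < 1 - (p : ℝ) ^ (-s) ∧ 0 < 1 - (polyRootCountMod ![g] p : ℝ) * (p : ℝ) ^ (-s) := by
  obtain ⟨hu0, hu1, hu2⟩ := rpow_neg_le_inv hp hs
  have hp2 : (2 : ℝ) ≤ p := by exact_mod_cast hp.two_le
  have hp0 : (0 : ℝ) < p := by linarith
  have hρ := bh_single_rootCount_le_sub_one hg hp
  have hρ0 : (0 : ℝ) ≤ polyRootCountMod ![g] p := Nat.cast_nonneg _
  refine ⟨by linarith, ?_⟩
  have h1 : (polyRootCountMod ![g] p : ℝ) * (p : ℝ) ^ (-s) ≤ ((p : ℝ) - 1) * (p : ℝ)⁻¹ :=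
    mul_le_mul hρ hu1 hu0.le (by linarith)
  have h2 : ((p : ℝ) - 1) * (p : ℝ)⁻¹ < 1 := by
    rw [mul_inv_lt_iff₀ hp0]
    linarith
  linarith

/-- A2a: positivity of the Euler factor `e_p(s)` for `s ≥ 1`. [folklore] -/
theorem eulerFactorBH_pos {p : ℕ} (hp : p.Prime) {s : ℝ} (hs : 1 ≤ s) : 0 < eBH(g, s, p) := by
  obtain ⟨h1, h2⟩ := eulerFactorBH_parts_pos hg hp hs
  exact mul_pos (inv_pos.mpr h1) h2

/-- A2b: `|log e_p(s) − (1 − ρ_g(p)) p^{-s}| ≤ bnd(p)` uniformly in `s ≥ 1`. [folklore] -/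
theorem abs_log_eulerFactorBH_sub_le {p : ℕ} (hp : p.Prime) {s : ℝ} (hs : 1 ≤ s) :
    |Real.log (eBH(g, s, p)) - (1 - (polyRootCountMod ![g] p : ℝ)) * (p : ℝ) ^ (-s)| ≤
      bnd(g, p) := by
  obtain ⟨hu0, hu1, hu2⟩ := rpow_neg_le_inv hp hs
  obtain ⟨h1, h2⟩ := eulerFactorBH_parts_pos hg hp hs
  have hp2 : (2 : ℝ) ≤ p := by exact_mod_cast hp.two_le
  have hp0 : (0 : ℝ) < p := by linarith
  set u : ℝ := (p : ℝ) ^ (-s) with hu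
  set ρ : ℝ := (polyRootCountMod ![g] p : ℝ) with hρdef
  set w : ℝ := ρ * u with hw
  set d : ℝ := (g.natDegree : ℝ) with hd
  have hρ0 : 0 ≤ ρ := Nat.cast_nonneg _
  have hw0 : 0 ≤ w := mul_nonneg hρ0 hu0.le
  have hρd : ρ ≤ d := bh_single_rootCount_le hg hp
  -- the decomposition of the remainder
  have hlog : Real.log (eBH(g, s, p)) = -Real.log (1 - u) + Real.log (1 - w) := by
    rw [Real.log_mul (inv_pos.mpr h1).ne' h2.ne', Real.log_inv]
  have e : Real.log (eBH(g, s, p)) - (1 - ρ) * u =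
      -(Real.log (1 - u) + u) + (Real.log (1 - w) + w) := by
    rw [hlog, hw]; ring
  rw [e]
  -- `p^{-2s} ≤ p^{-2}`
  have hu_sq : u ^ 2 ≤ (p : ℝ) ^ (-2 : ℝ) := by
    calc u ^ 2 ≤ ((p : ℝ)⁻¹) ^ 2 := pow_le_pow_left₀ hu0.le hu1 2
      _ = (p : ℝ) ^ (-2 : ℝ) := by
        rw [show (-2 : ℝ) = -(2 : ℝ) by norm_num, Real.rpow_neg hp0.le, Real.rpow_two, inv_pow]
  have b1 : |Real.log (1 - u) + u| ≤ 2 * u ^ 2 := abs_log_one_sub_add_le hu0.le (hu1.trans hu2)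
  have hnn : 0 ≤ (p : ℝ) ^ (-2 : ℝ) := Real.rpow_nonneg hp0.le _
  -- the `w`-term, by cases on the size of `p`
  have b2 : |Real.log (1 - w) + w| ≤ 2 * d ^ 2 * (p : ℝ) ^ (-2 : ℝ) +
      (if p ≤ 2 * g.natDegree then Real.log (p : ℝ) + 1 else 0) := by
    by_cases hsmall : p ≤ 2 * g.natDegree
    · rw [if_pos hsmall]
      -- crude bound: `1 - w ≥ 1/p`, `w ≤ 1`
      have hρp : ρ ≤ (p : ℝ) - 1 := bh_single_rootCount_le_sub_one hg hp
      have hw1 : w ≤ ((p : ℝ) - 1) * (p : ℝ)⁻¹ := mul_le_mul hρp hu1 hu0.le (by linarith)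
      have hwp : (p : ℝ)⁻¹ ≤ 1 - w := by
        have : ((p : ℝ) - 1) * (p : ℝ)⁻¹ = 1 - (p : ℝ)⁻¹ := by field_simp
        linarith
      have hw_le_one : w ≤ 1 := by
        have : (p : ℝ)⁻¹ > 0 := inv_pos.mpr hp0
        linarith
      have hlogw : |Real.log (1 - w)| ≤ Real.log p := by
        rw [abs_of_nonpos (Real.log_nonpos (by linarith) (by linarith))]
        have := Real.log_le_log (inv_pos.mpr hp0) hwp
        rw [Real.log_inv] at this
        linarith
      calc |Real.log (1 - w) + w| ≤ |Real.log (1 - w)| + |w| := abs_add_le _ _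
        _ ≤ Real.log p + 1 := by rw [abs_of_nonneg hw0]; linarith
        _ ≤ 2 * d ^ 2 * (p : ℝ) ^ (-2 : ℝ) + (Real.log (p : ℝ) + 1) := by
          have : 0 ≤ 2 * d ^ 2 * (p : ℝ) ^ (-2 : ℝ) := by positivity
          linarith
    · rw [if_neg hsmall, add_zero]
      have hlt : (2 * g.natDegree : ℝ) < p := by exact_mod_cast (not_le.mp hsmall)
      have hwd : w ≤ d * u := mul_le_mul_of_nonneg_right hρd hu0.le
      have hw2 : w ≤ 1 / 2 := by
        have hdu : d * u ≤ d * (p : ℝ)⁻¹ := mul_le_mul_of_nonneg_left hu1 (Nat.cast_nonneg _)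
        have : d * (p : ℝ)⁻¹ ≤ 1 / 2 := by
          rw [← div_eq_mul_inv, div_le_iff₀ hp0]
          rw [hd]; linarith
        linarith
      calc |Real.log (1 - w) + w| ≤ 2 * w ^ 2 := abs_log_one_sub_add_le hw0 hw2
        _ ≤ 2 * (d * u) ^ 2 := by gcongr
        _ = 2 * d ^ 2 * u ^ 2 := by ring
        _ ≤ 2 * d ^ 2 * (p : ℝ) ^ (-2 : ℝ) := by gcongr
  calc |-(Real.log (1 - u) + u) + (Real.log (1 - w) + w)|
      ≤ |-(Real.log (1 - u) + u)| + |Real.log (1 - w) + w| := abs_add_le _ _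
    _ = |Real.log (1 - u) + u| + |Real.log (1 - w) + w| := by rw [abs_neg]
    _ ≤ 2 * u ^ 2 + (2 * d ^ 2 * (p : ℝ) ^ (-2 : ℝ) +
          (if p ≤ 2 * g.natDegree then Real.log (p : ℝ) + 1 else 0)) := add_le_add b1 b2
    _ ≤ 2 * (p : ℝ) ^ (-2 : ℝ) + (2 * d ^ 2 * (p : ℝ) ^ (-2 : ℝ) +
          (if p ≤ 2 * g.natDegree then Real.log (p : ℝ) + 1 else 0)) := by gcongr
    _ = bnd(g, p) := by rw [hd]; ring

omit hg in
/-- Continuity of `s ↦ p^{-s}` (for `p > 0`). [folklore] -/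
theorem continuousAt_rpow_neg {p : ℕ} (hp : p.Prime) (s₀ : ℝ) :
    ContinuousAt (fun s : ℝ => (p : ℝ) ^ (-s)) s₀ := by
  have hp0 : (p : ℝ) ≠ 0 := by exact_mod_cast hp.ne_zero
  exact (Real.continuousAt_const_rpow (b := -s₀) hp0).comp (continuous_neg.continuousAt)

/-- A2c: continuity at `s = 1` of the remainder `log e_p(s) − (1 − ρ_g(p)) p^{-s}`. [folklore] -/
theorem tendsto_log_eulerFactorBH_sub {p : ℕ} (hp : p.Prime) :
    Tendsto (fun s : ℝ => Real.log (eBH(g, s, p)) -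
        (1 - (polyRootCountMod ![g] p : ℝ)) * (p : ℝ) ^ (-s))
      (𝓝[>] 1) (𝓝 (Real.log (eBH(g, 1, p)) -
        (1 - (polyRootCountMod ![g] p : ℝ)) * (p : ℝ) ^ (-(1 : ℝ)))) := by
  obtain ⟨h1, h2⟩ := eulerFactorBH_parts_pos hg hp le_rfl
  have hu := continuousAt_rpow_neg hp 1
  have hc : ContinuousAt (fun s : ℝ => Real.log (eBH(g, s, p)) -
      (1 - (polyRootCountMod ![g] p : ℝ)) * (p : ℝ) ^ (-s)) 1 := by
    refine ContinuousAt.sub ?_ (hu.const_mul _)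
    refine ContinuousAt.log (ContinuousAt.mul ?_ ?_) (mul_pos (inv_pos.mpr h1) h2).ne'
    · exact (continuousAt_const.sub hu).inv₀ h1.ne'
    · exact continuousAt_const.sub (hu.const_mul _)
  exact hc.tendsto.mono_left nhdsWithin_le_nhds

omit hg in
/-- The majorant `bnd` is summable over the primes. [folklore] -/
theorem summable_bnd : Summable fun p : Nat.Primes => bnd(g, p) := by
  refine Summable.add (((Nat.Primes.summable_rpow (r := -2)).mpr (by norm_num)).mul_left _) ?_
  refine summable_of_ne_finset_zero (s := ((Finset.range (2 * g.natDegree + 1)).filter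
    Nat.Prime).subtype Nat.Prime) ?_
  intro p hp
  rw [if_neg]
  intro hle
  exact hp (Finset.mem_subtype.mpr (Finset.mem_filter.mpr
    ⟨Finset.mem_range.mpr (Nat.lt_succ_of_le hle), p.prop⟩))

/-- Summability of the remainders over the primes, `s ≥ 1`. [folklore] -/
theorem summable_logErr {s : ℝ} (hs : 1 ≤ s) :
    Summable fun p : Nat.Primes => Real.log (eBH(g, s, p)) -
      (1 - (polyRootCountMod ![g] p : ℝ)) * (p : ℝ) ^ (-s) := by
  refine Summable.of_norm_bounded (summable_bnd (g := g)) fun p => ?_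
  rw [Real.norm_eq_abs]
  exact abs_log_eulerFactorBH_sub_le hg p.prop hs

/-- Summability of the main terms `(1 − ρ_g(p)) p^{-s}` over the primes, `s > 1`. [folklore] -/
theorem summable_main {s : ℝ} (hs : 1 < s) :
    Summable fun p : Nat.Primes => (1 - (polyRootCountMod ![g] p : ℝ)) * (p : ℝ) ^ (-s) := by
  refine Summable.of_norm_bounded
    ((Nat.Primes.summable_rpow.mpr (by linarith : -s < -1)).mul_left ((g.natDegree : ℝ) + 1))
    fun p => ?_
  rw [Real.norm_eq_abs, abs_mul, abs_of_nonneg (Real.rpow_nonneg (Nat.cast_nonneg _) _)]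
  refine mul_le_mul_of_nonneg_right ?_ (Real.rpow_nonneg (Nat.cast_nonneg _) _)
  have h1 := bh_single_rootCount_le hg p.prop
  have h0 : (0 : ℝ) ≤ polyRootCountMod ![g] p := Nat.cast_nonneg _
  rw [abs_le]; constructor <;> linarith

/-- Summability of `log e_p(s)` over the primes, `s > 1`, and the split of its sum. [folklore] -/
theorem summable_log_eulerFactorBH {s : ℝ} (hs : 1 < s) :
    Summable (fun p : Nat.Primes => Real.log (eBH(g, s, p))) ∧
      ∑' p : Nat.Primes, Real.log (eBH(g, s, p)) =
        ∑' p : Nat.Primes, (1 - (polyRootCountMod ![g] p : ℝ)) * (p : ℝ) ^ (-s) +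
          ∑' p : Nat.Primes, (Real.log (eBH(g, s, p)) -
            (1 - (polyRootCountMod ![g] p : ℝ)) * (p : ℝ) ^ (-s)) := by
  have hA := summable_main hg hs
  have hB := summable_logErr hg hs.le
  have hsum : Summable (fun p : Nat.Primes => Real.log (eBH(g, s, p))) := by
    refine (hA.add hB).congr fun p => ?_
    ring
  refine ⟨hsum, ?_⟩
  rw [← hA.tsum_add hB]
  exact tsum_congr fun p => by ring

/-- A3: the Abelian limit of `Σ_p (1 − ρ_g(p)) p^{-s}` (`s → 1⁺`) exists: `ρ_g(p) = c_K(p)` off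
finitely many primes for `K = ℚ[X]/(g₁)`, and `Σ_p (c_K(p) − 1) p^{-s}` converges as `s → 1⁺`
(`exists_tendsto_tsum_primes_idealNormCount_sub_one`). [folklore] -/
theorem exists_tendsto_tsum_primes_one_sub_rootCount :
    ∃ S : ℝ, Tendsto (fun s : ℝ => ∑' p : Nat.Primes,
      (1 - (polyRootCountMod ![g] p : ℝ)) * (p : ℝ) ^ (-s)) (𝓝[>] 1) (𝓝 S) := by
  have hirr := bh_single_irreducible hg
  have hdeg : 0 < g.natDegree := by simpa using hg.natDegree_pos 0
  haveI : Fact (Irreducible ((integralNormalization g).map (algebraMap ℤ ℚ))) :=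
    ⟨DegreeOnePrimes.irreducible_map_rat (monic_integralNormalization hirr.ne_zero)
      (irreducible_integralNormalization hirr hdeg)⟩
  obtain ⟨e, he, hgood⟩ := exists_rootExcess_prime_eq_zero hirr hdeg
  set K := AdjoinRoot ((integralNormalization g).map (algebraMap ℤ ℚ)) with hK
  obtain ⟨L, hL⟩ := exists_tendsto_tsum_primes_idealNormCount_sub_one K
  have hmatch : ∀ p : ℕ, p.Prime → ¬ p ∣ e →
      (idealNormCount K p : ℝ) = polyRootCountMod ![g] p := by
    intro p hp hpe
    have h := hgood p hp hpe
    rw [rootExcess_prime g K hp, sub_eq_zero] at h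
    have h' : idealNormCount K p = polyRootCountMod ![g] p := by exact_mod_cast h
    rw [h']
  set δ : Nat.Primes → ℝ := fun p => (idealNormCount K p : ℝ) - polyRootCountMod ![g] p with hδ
  set T : Finset Nat.Primes := (e.primeFactors).subtype Nat.Prime with hT
  have hδ0 : ∀ p : Nat.Primes, p ∉ T → δ p = 0 := by
    intro p hp
    have hpe : ¬ (p : ℕ) ∣ e := fun hdvd =>
      hp (Finset.mem_subtype.mpr (Nat.mem_primeFactors.mpr ⟨p.prop, hdvd, he.ne'⟩))
    simp only [hδ]
    rw [hmatch p p.prop hpe, sub_self]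
  have h2 : Tendsto (fun s : ℝ => ∑ p ∈ T, δ p * (p : ℝ) ^ (-s)) (𝓝[>] 1)
      (𝓝 (∑ p ∈ T, δ p * (p : ℝ) ^ (-(1 : ℝ)))) := by
    refine (tendsto_finsetSum T fun p _ => ?_).mono_left nhdsWithin_le_nhds
    exact ((continuousAt_rpow_neg p.prop 1).const_mul (δ p)).tendsto
  refine ⟨-L + ∑ p ∈ T, δ p * (p : ℝ) ^ (-(1 : ℝ)), (hL.neg.add h2).congr' ?_⟩
  filter_upwards [self_mem_nhdsWithin] with s (hs : 1 < s)
  have hS1 : Summable fun p : Nat.Primes => ((idealNormCount K p : ℝ) - 1) * (p : ℝ) ^ (-s) := by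
    refine Summable.of_norm_bounded ((Nat.Primes.summable_rpow.mpr
      (by linarith : -s < -1)).mul_left ((2 : ℝ) ^ Module.finrank ℚ K + 1)) fun p => ?_
    rw [Real.norm_eq_abs, abs_mul, abs_of_nonneg (Real.rpow_nonneg (Nat.cast_nonneg _) _)]
    refine mul_le_mul_of_nonneg_right ?_ (Real.rpow_nonneg (Nat.cast_nonneg _) _)
    have h1 := idealNormCount_prime_le K p.prop
    have h0 : (0 : ℝ) ≤ idealNormCount K p := Nat.cast_nonneg _
    have h2 : (0 : ℝ) ≤ (2 : ℝ) ^ Module.finrank ℚ K := pow_nonneg zero_le_two _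
    rw [abs_le]; constructor <;> linarith
  have hS2 : Summable fun p : Nat.Primes => δ p * (p : ℝ) ^ (-s) :=
    summable_of_ne_finset_zero (s := T) fun p hp => by rw [hδ0 p hp, zero_mul]
  have h3 : ∑' p : Nat.Primes, δ p * (p : ℝ) ^ (-s) = ∑ p ∈ T, δ p * (p : ℝ) ^ (-s) :=
    tsum_eq_sum fun p hp => by rw [hδ0 p hp, zero_mul]
  have h4 : ∑' p : Nat.Primes, -(((idealNormCount K p : ℝ) - 1) * (p : ℝ) ^ (-s)) =
      -∑' p : Nat.Primes, ((idealNormCount K p : ℝ) - 1) * (p : ℝ) ^ (-s) := tsum_neg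
  rw [← h3, ← h4, ← hS1.neg.tsum_add hS2]
  refine tsum_congr fun p => ?_
  simp only [hδ]
  ring

/-- The Bateman–Horn partial product of `![g]` is the ordered product of the `e_p(1)`.
[folklore] -/
theorem log_batemanHornPartial_eq (x : ℕ) :
    Real.log (batemanHornPartial ![g] x) = ∑ p ∈ Nat.primesLE x, Real.log (eBH(g, 1, p)) := by
  unfold batemanHornPartial
  rw [Real.log_prod]
  · refine Finset.sum_congr rfl fun p hp => ?_
    have hp' : (p : ℕ).Prime := (Nat.mem_primesLE.mp hp).2
    congr 1
    rw [Fintype.card_fin, pow_one, Real.rpow_neg_one, one_div, div_eq_mul_inv]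
  · intro p hp
    have hp' : (p : ℕ).Prime := (Nat.mem_primesLE.mp hp).2
    have h := eulerFactorBH_pos hg hp' le_rfl
    rw [Fintype.card_fin, pow_one, one_div]
    rw [Real.rpow_neg_one, ← div_eq_mul_inv] at h
    exact h.ne'

/-- A5–A6: `Σ_p log e_p(s) → log C(![g])` as `s → 1⁺` — the Tauberian matching
(`PrimeSum.tendsto_sum_primesLE_div`) of the Abelian limit with the ordered one, Tannery's
theorem for the remainders, and `IsBatemanHornSystem.hasBatemanHornConst_holds`. [folklore] -/
theorem tendsto_tsum_log_eulerFactorBH :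
    Tendsto (fun s : ℝ => ∑' p : Nat.Primes, Real.log (eBH(g, s, p))) (𝓝[>] 1)
      (𝓝 (Real.log (batemanHornConst ![g]))) := by
  obtain ⟨hC, hCpos⟩ := IsBatemanHornSystem.hasBatemanHornConst_holds hg
  obtain ⟨S, hS⟩ := exists_tendsto_tsum_primes_one_sub_rootCount hg
  -- the remainder at `s = 1` and its sum `U₁`
  set err₁ : ℕ → ℝ := fun p => Real.log (eBH(g, 1, p)) -
    (1 - (polyRootCountMod ![g] p : ℝ)) * (p : ℝ) ^ (-(1 : ℝ)) with herr₁
  have hU : Summable fun p : Nat.Primes => err₁ p := summable_logErr hg le_rfl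
  set U₁ : ℝ := ∑' p : Nat.Primes, err₁ p with hU₁
  -- (1) Tauberian matching: the ordered main sums converge to the Abelian limit `S`
  have hT : Tendsto (fun x : ℕ => ∑ p ∈ Nat.primesLE x,
      (1 - (polyRootCountMod ![g] p : ℝ)) / p) atTop (𝓝 S) := by
    refine PrimeSum.tendsto_sum_primesLE_div (a := fun p => 1 - (polyRootCountMod ![g] p : ℝ))
      (B := (g.natDegree : ℝ) + 1) (fun p hp => ?_) hS
    have h1 := bh_single_rootCount_le hg hp
    have h0 : (0 : ℝ) ≤ polyRootCountMod ![g] p := Nat.cast_nonneg _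
    rw [abs_le]; constructor <;> linarith
  -- (2) the ordered remainder sums converge to `U₁`
  have hE : Tendsto (fun x : ℕ => ∑ p ∈ Nat.primesLE x, err₁ p) atTop (𝓝 U₁) :=
    (LogEulerProduct.tendsto_sum_primesBelow (F := err₁) hU).comp (tendsto_add_atTop_nat 1)
  -- (3) the ordered log-products converge to `log C`
  have hP : Tendsto (fun x : ℕ => ∑ p ∈ Nat.primesLE x, Real.log (eBH(g, 1, p))) atTop
      (𝓝 (Real.log (batemanHornConst ![g]))) := by
    have h1 : Tendsto (fun x : ℕ => Real.log (batemanHornPartial ![g] x)) atTop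
        (𝓝 (Real.log (batemanHornConst ![g]))) :=
      (Real.continuousAt_log hCpos.ne').tendsto.comp hC
    refine h1.congr fun x => ?_
    exact log_batemanHornPartial_eq hg x
  -- hence `log C = S + U₁`
  have hsplit : ∀ x : ℕ, ∑ p ∈ Nat.primesLE x, Real.log (eBH(g, 1, p)) =
      ∑ p ∈ Nat.primesLE x, (1 - (polyRootCountMod ![g] p : ℝ)) / p +
        ∑ p ∈ Nat.primesLE x, err₁ p := by
    intro x
    rw [← Finset.sum_add_distrib]
    refine Finset.sum_congr rfl fun p _ => ?_
    simp only [herr₁, Real.rpow_neg_one, div_eq_mul_inv]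
    ring
  have hlogC : Real.log (batemanHornConst ![g]) = S + U₁ :=
    tendsto_nhds_unique hP ((hT.add hE).congr fun x => (hsplit x).symm)
  -- (4) `s → 1⁺`: Abelian limit of the main sums plus Tannery for the remainders
  have hTan : Tendsto (fun s : ℝ => ∑' p : Nat.Primes, (Real.log (eBH(g, s, p)) -
      (1 - (polyRootCountMod ![g] p : ℝ)) * (p : ℝ) ^ (-s))) (𝓝[>] 1) (𝓝 U₁) := by
    refine tendsto_tsum_of_dominated_convergence (bound := fun p : Nat.Primes => bnd(g, p))
      (summable_bnd (g := g)) (fun p => tendsto_log_eulerFactorBH_sub hg p.prop) ?_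
    filter_upwards [self_mem_nhdsWithin] with s (hs : 1 < s)
    intro p
    rw [Real.norm_eq_abs]
    exact abs_log_eulerFactorBH_sub_le hg p.prop hs.le
  rw [hlogC]
  refine (hS.add hTan).congr' ?_
  filter_upwards [self_mem_nhdsWithin] with s (hs : 1 < s)
  exact ((summable_log_eulerFactorBH hg hs).2).symm

/-- A6: `exp Σ_p log e_p(s) → C(![g])` as `s → 1⁺`. [folklore] -/
theorem tendsto_exp_tsum_log_eulerFactorBH :
    Tendsto (fun s : ℝ => Real.exp (∑' p : Nat.Primes, Real.log (eBH(g, s, p)))) (𝓝[>] 1)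
      (𝓝 (batemanHornConst ![g])) := by
  obtain ⟨-, hCpos⟩ := IsBatemanHornSystem.hasBatemanHornConst_holds hg
  have h : Tendsto (fun s : ℝ => Real.exp (∑' p : Nat.Primes, Real.log (eBH(g, s, p)))) (𝓝[>] 1)
      (𝓝 (Real.exp (Real.log (batemanHornConst ![g])))) :=
    (Real.continuous_exp.tendsto _).comp (tendsto_tsum_log_eulerFactorBH hg)
  rwa [Real.exp_log hCpos] at h

/-- A7: for `s > 1` the partial Euler products converge to `exp Σ_p log e_p(s)`. [folklore] -/
theorem tendsto_prod_primesBelow_eulerFactorBH {s : ℝ} (hs : 1 < s) :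
    Tendsto (fun N : ℕ => ∏ p ∈ primesBelow N, eBH(g, s, p)) atTop
      (𝓝 (Real.exp (∑' p : Nat.Primes, Real.log (eBH(g, s, p))))) := by
  have hsum := (summable_log_eulerFactorBH hg hs).1
  have h1 := LogEulerProduct.tendsto_sum_primesBelow (F := fun p : ℕ => Real.log (eBH(g, s, p))) hsum
  have h2 : Tendsto (fun N : ℕ => Real.exp (∑ p ∈ primesBelow N, Real.log (eBH(g, s, p)))) atTop
      (𝓝 (Real.exp (∑' p : Nat.Primes, Real.log (eBH(g, s, p))))) :=
    (Real.continuous_exp.tendsto _).comp h1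
  have heq : (fun N : ℕ => ∏ p ∈ primesBelow N, eBH(g, s, p)) =
      fun N : ℕ => Real.exp (∑ p ∈ primesBelow N, Real.log (eBH(g, s, p))) := by
    funext N
    rw [Real.exp_sum]
    exact Finset.prod_congr rfl fun p hp =>
      (Real.exp_log (eulerFactorBH_pos hg (Nat.mem_primesBelow.mp hp).2 hs.le)).symm
  rw [heq]
  exact h2

/-- B1: the Euler product of the real Dirichlet series `F(s) = Σ μ(n)ρ_g(n) n^{-s}`, `s > 1`:
its `p`-factor is `1 − ρ_g(p) p^{-s}`. [folklore] -/
theorem tendsto_prod_primesBelow_moebiusRootCount {s : ℝ} (hs : 1 < s) :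
    Tendsto (fun N : ℕ => ∏ p ∈ primesBelow N,
      (1 - (polyRootCountMod ![g] p : ℝ) * (p : ℝ) ^ (-s))) atTop (𝓝 (Fℝ(g, s))) := by
  have hirr := bh_single_irreducible hg
  have hdeg : 0 < g.natDegree := by simpa using hg.natDegree_pos 0
  set f : ℕ → ℝ := fun n => (ArithmeticFunction.moebius n : ℝ) *
    (polyRootCountMod ![g] n : ℝ) * (n : ℝ) ^ (-s) with hf
  have hf₁ : f 1 = 1 := by
    simp [hf, polyRootCountMod_single_one]
  have hf₀ : f 0 = 0 := by simp [hf]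
  have hmul : ∀ {m n : ℕ}, Nat.Coprime m n → f (m * n) = f m * f n := by
    intro m n hmn
    simp only [hf]
    rw [ArithmeticFunction.isMultiplicative_moebius.map_mul_of_coprime hmn,
      polyRootCountMod_mul_of_coprime g hmn, Nat.cast_mul, Nat.cast_mul, Int.cast_mul,
      Real.mul_rpow (Nat.cast_nonneg _) (Nat.cast_nonneg _)]
    ring
  have hsum : Summable (fun n => ‖f n‖) := by
    have hL := (lseriesSummable_moebiusRootCount hirr hdeg hs).norm
    refine hL.congr fun n => ?_
    rw [LSeries.norm_term_eq]
    rcases eq_or_ne n 0 with rfl | hn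
    · simp [hf]
    · rw [if_neg hn, moebiusRootCount_apply, norm_mul, Complex.norm_intCast,
        Complex.norm_natCast, Complex.ofReal_re, hf]
      dsimp only
      rw [norm_mul, norm_mul, Real.norm_eq_abs, Real.norm_eq_abs, Real.norm_eq_abs,
        Nat.abs_cast, abs_of_nonneg (Real.rpow_nonneg (Nat.cast_nonneg _) _),
        Real.rpow_neg (Nat.cast_nonneg _), div_eq_mul_inv]
  have hE := EulerProduct.eulerProduct hf₁ hmul hsum hf₀
  have hloc : ∀ {p : ℕ}, p.Prime →
      ∑' e, f (p ^ e) = 1 - (polyRootCountMod ![g] p : ℝ) * (p : ℝ) ^ (-s) := by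
    intro p hp
    rw [tsum_eq_sum (s := {0, 1}) ?_]
    · rw [Finset.sum_pair (by norm_num), pow_zero, pow_one, hf₁]
      simp only [hf]
      rw [ArithmeticFunction.moebius_apply_prime hp]
      push_cast
      ring
    · intro e he
      have he2 : 2 ≤ e := by
        simp only [Finset.mem_insert, Finset.mem_singleton] at he
        omega
      simp only [hf]
      rw [ArithmeticFunction.moebius_apply_prime_pow hp (by omega)]
      simp [show e ≠ 1 by omega]
  refine hE.congr' (Eventually.of_forall fun N => ?_)
  exact Finset.prod_congr rfl fun p hp => hloc (Nat.mem_primesBelow.mp hp).2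

omit hg in
/-- B2: the Euler product of the real zeta series `Σ_n n^{-s}`, `s > 1`. [folklore] -/
theorem tendsto_prod_primesBelow_zetaReal {s : ℝ} (hs : 1 < s) :
    Tendsto (fun N : ℕ => ∏ p ∈ primesBelow N, (1 - (p : ℝ) ^ (-s))⁻¹) atTop (𝓝 (ζℝ(s))) := by
  have hs0 : -s ≠ 0 := by
    intro h
    linarith
  let f : ℕ →*₀ ℝ :=
    { toFun := fun n => (n : ℝ) ^ (-s)
      map_zero' := by simp [Real.zero_rpow hs0]
      map_one' := by simp
      map_mul' := fun m n => by
        simp only [Nat.cast_mul]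
        exact Real.mul_rpow (Nat.cast_nonneg _) (Nat.cast_nonneg _) }
  have hsum : Summable (fun n => ‖f n‖) := by
    have := Real.summable_nat_rpow.mpr (by linarith : -s < -1)
    refine this.congr fun n => ?_
    simp only [f, MonoidWithZeroHom.coe_mk, ZeroHom.coe_mk, Real.norm_eq_abs]
    rw [abs_of_nonneg (Real.rpow_nonneg (Nat.cast_nonneg _) _)]
  exact EulerProduct.eulerProduct_completely_multiplicative hsum

/-- B3: **`F(s) ζ(s) → C(![g])` as `s → 1⁺`** (real): for `s > 1`, `F(s) ζ(s)` is the Euler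
product `∏_p e_p(s) = exp Σ_p log e_p(s)`. [folklore] -/
theorem tendsto_moebiusRootCount_mul_zetaReal :
    Tendsto (fun s : ℝ => Fℝ(g, s) * ζℝ(s)) (𝓝[>] 1) (𝓝 (batemanHornConst ![g])) := by
  refine (tendsto_exp_tsum_log_eulerFactorBH hg).congr' ?_
  filter_upwards [self_mem_nhdsWithin] with s (hs : 1 < s)
  have h1 := tendsto_prod_primesBelow_eulerFactorBH hg hs
  have h2 := (tendsto_prod_primesBelow_zetaReal hs).mul
    (tendsto_prod_primesBelow_moebiusRootCount hg hs)
  have h3 : Tendsto (fun N : ℕ => ∏ p ∈ primesBelow N, eBH(g, s, p)) atTop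
      (𝓝 (ζℝ(s) * Fℝ(g, s))) := by
    refine h2.congr fun N => ?_
    rw [← Finset.prod_mul_distrib]
  exact (tendsto_nhds_unique h1 h3).trans (mul_comm _ _)

end RealSide

/-- **The Bateman–Horn constant as an analytic limit**: for a one-polynomial Bateman–Horn
system, `(Σ_n μ(n)ρ_g(n) n^{-s}) · (Σ_n n^{-s}) → C(![g])` as `s → 1⁺`, i.e.
`C(![g]) = lim_{s→1⁺} ζ(s)·∏_p (1 − ρ_g(p)p^{-s}) = lim_{s→1⁺} ∏_p (1 − p^{-s})⁻¹(1 − ρ_g(p)p^{-s})`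
— the conditionally convergent ordered product at `s = 1` is the Abelian limit of the absolutely
convergent ones. [cite: BatemanHornMathComp1962, §2 (the constant C(f) and its Euler product)] -/
theorem tendsto_moebiusRootCountSeries_mul_zeta_batemanHornConst {g : ℤ[X]}
    (hg : IsBatemanHornSystem ![g]) :
    Tendsto (fun s : ℝ => (∑' n : ℕ, (ArithmeticFunction.moebius n : ℝ) *
      (polyRootCountMod ![g] n : ℝ) * (n : ℝ) ^ (-s)) * ∑' n : ℕ, (n : ℝ) ^ (-s))
      (𝓝[>] 1) (𝓝 (batemanHornConst ![g])) :=
  tendsto_moebiusRootCount_mul_zetaReal hg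


end Literature.NumberTheory.LFunctions
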